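import Summits.NavierStokesRegularity.NavierStokesRegularity.Theorems.PerpetualPumpAveragedTypeIBlowupTrailPairTools

/-!
# Crux `PerpetualPump.AveragedTypeIBlowup` (stmt-NavierStokesRegularity-1835), line `Sketch`:
# tools for the stub `levelOnePre` — the level-1 carrier/bond pair of the front before ignition

This file collects the Mathlib-only real-analysis tools used by the registered stub
`stub_levelOnePre` of the line skeleton `Cruxes/AveragedTypeIBlowup/Lines/Sketch.lean` (the stub
itself is proved in `PerpetualPumpAveragedTypeIBlowupLevelOnePre.lean`). Data of the stub, in the
slow time `σ` of the front (the level-1 pair runs at relative rate `q⁴`, `q ∈ [1, 21/20]`): the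
next carrier `x' = q⁴(-x + w²/q³ - y² - ε̄ x y) + eₓ`, fed only by the pre-ignition front bond
`w` (`w² ≤ Bx/100` pointwise, `∫₀^σ w² ≤ Iw`), the next bond
`y' = q⁴(y (x - x₂/q - 1) + ε̄ x²) + e_y` (`|x₂| ≤ 1/2`), memory errors `|eₓ| ≤ η q⁴ mx`,
`|e_y| ≤ η q⁴ my`, `ε̄ ≤ 10⁻⁶`, `η Bx ≤ 10⁻⁴`, seeds `|x(0)|, |y(0)| ≤ ε̄`.

* `levelOnePre_majorant` — kernel mass: `m ≤ M e^{-κτ} + L ∫₀^τ e^{-κ(τ-u)} |g|`, `|g| ≤ C`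
  ⇒ `m ≤ M e^{-κτ} + L C / κ` (`trailPair_integral_kernel_le`).
* `levelOnePre_carrier_upper` — variation of constants in supersolution form: if
  `x' + R x ≤ R A + p` inside with `p = P'`, `P(0) = 0`, `P ≥ 0`, then
  `x(τ) ≤ x(0) e^{-Rτ} + A + P(τ)` (the difference `d` obeys `d' ≤ -R d`, `d(0) = -A ≤ 0`;
  `trailPair_nonpos_of_deriv_le`).
* `levelOnePre_carrier` — under the loose box `|x| ≤ 1/20`, `|y| ≤ 2ε̄`, `mx ≤ ε̄ + Bx/20` on
  `[0, T]`: `x' + q⁴ x ≤ q⁴ A + q w²` and `(-x)' + q⁴(-x) ≤ q⁴ A` with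
  `A = 5ε̄² + η(ε̄ + Bx/20) ≤ 10⁻³`, whence `|x| ≤ ε̄ + A + q ∫₀^σ w² ≤ ε̄ + q Iw + 10⁻³`.
* `levelOnePre_bond` — under `|x| ≤ 1/20`, `my ≤ 8ε̄`: the bond rate is
  `q⁴(x - x₂/q - 1) ≤ -(9/20) q⁴` and the forcing is `≤ q⁴ ε̄ (1/400 + 8η)`, whence
  (`trailPair_bond`) `|y| ≤ ε̄/10 + ε̄`.

## References

* T. Tao, *Finite time blowup for an averaged three-dimensional Navier–Stokes equation*, J. Amer.
  Math. Soc. 29 (2016), 601–674, §5–6 (the pre-ignition bookkeeping is a folklore ODE bootstrap).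
-/

noncomputable section

-- the summit namespace `…NavierStokesRegularity.NavierStokesRegularity…` is the tree convention
set_option linter.dupNamespace false

open MeasureTheory Set Filter Topology

namespace Summit.NavierStokesRegularity.NavierStokesRegularity.Theorems.PerpetualPumpAveragedTypeIBlowup

/-- **Duhamel majorant with a rate prefactor.** If `g` is continuous with `|g| ≤ C` on `[0, τ]`,
`κ > 0`, `L ≥ 0` and `m ≤ M e^{-κ τ} + L ∫₀^τ e^{-κ (τ - u)} |g(u)| du`, then
`m ≤ M e^{-κ τ} + L C / κ` (the kernel has mass `≤ 1/κ`, `trailPair_integral_kernel_le`).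
[folklore] -/
theorem levelOnePre_majorant {g : ℝ → ℝ} {κ C L M τ m : ℝ} (hκ : 0 < κ) (hC : 0 ≤ C)
    (hL : 0 ≤ L) (hτ : 0 ≤ τ) (hg : ContinuousOn g (Icc 0 τ)) (hgC : ∀ u ∈ Icc 0 τ, |g u| ≤ C)
    (hm : m ≤ M * Real.exp (-(κ * τ)) +
      L * ∫ u in (0 : ℝ)..τ, Real.exp (-(κ * (τ - u))) * |g u|) :
    m ≤ M * Real.exp (-(κ * τ)) + L * (C / κ) := by
  have hEc : Continuous fun u : ℝ => Real.exp (-(κ * (τ - u))) := by fun_prop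
  have hi1 : IntervalIntegrable (fun u => Real.exp (-(κ * (τ - u))) * |g u|) volume 0 τ :=
    (hEc.continuousOn.mul (continuous_abs.comp_continuousOn hg)).intervalIntegrable_of_Icc hτ
  have hi2 : IntervalIntegrable (fun u => Real.exp (-(κ * (τ - u))) * C) volume 0 τ :=
    (hEc.mul continuous_const).intervalIntegrable 0 τ
  have hmono : ∫ u in (0 : ℝ)..τ, Real.exp (-(κ * (τ - u))) * |g u| ≤
      ∫ u in (0 : ℝ)..τ, Real.exp (-(κ * (τ - u))) * C :=
    intervalIntegral.integral_mono_on hτ hi1 hi2 fun u hu =>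
      mul_le_mul_of_nonneg_left (hgC u hu) (Real.exp_pos _).le
  have hint := trailPair_integral_kernel_le hκ hC τ
  have h1 := mul_le_mul_of_nonneg_left (hmono.trans hint) hL
  linarith

/-- **Variation of constants, supersolution form.** If `x, P` are continuous on `[0, T]`,
`P(0) = 0`, `P ≥ 0` and `P' = p` inside, `R, A ≥ 0`, and `x' + R x ≤ R A + p` at interior points,
then `x(τ) - x(0) e^{-R τ} ≤ A + P(τ)` on `[0, T]`: the difference
`d = x - x(0) e^{-R t} - (A + P)` satisfies `d' ≤ -R d`, `d(0) = -A ≤ 0` (registered tools sub-goal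
`levelOnePre_carrier_upper` of stmt-NavierStokesRegularity-1835). [folklore] -/
theorem levelOnePre_carrier_upper :
    ∀ {x P p : ℝ → ℝ} {R A T : ℝ}, 0 ≤ T → 0 ≤ R → 0 ≤ A → ContinuousOn x (Icc 0 T) →
      ContinuousOn P (Icc 0 T) → P 0 = 0 → (∀ t ∈ Ioo 0 T, 0 ≤ P t) →
      (∀ t ∈ Ioo 0 T, HasDerivAt P (p t) t) →
      (∀ t ∈ Ioo 0 T, ∃ x' : ℝ, HasDerivAt x x' t ∧ x' + R * x t ≤ R * A + p t) →
      ∀ τ ∈ Icc 0 T, x τ - x 0 * Real.exp (-(R * τ)) ≤ A + P τ := by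
  intro x P p R A T hT hR hA hx hP hP0 hPnn hPd hd
  have hex : ∀ u : ℝ, HasDerivAt (fun u => x 0 * Real.exp (-(R * u)))
      (x 0 * (Real.exp (-(R * u)) * -(R * 1))) u := fun u =>
    ((hasDerivAt_id' u).const_mul R).neg.exp.const_mul (x 0)
  have hexc : Continuous fun u => x 0 * Real.exp (-(R * u)) := by fun_prop
  have hdc : ContinuousOn (fun u => x u - x 0 * Real.exp (-(R * u)) - (A + P u)) (Icc 0 T) :=
    (hx.sub hexc.continuousOn).sub (continuousOn_const.add hP)
  have hdd : ∀ t ∈ Ioo 0 T, ∃ d' : ℝ,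
      HasDerivAt (fun u => x u - x 0 * Real.exp (-(R * u)) - (A + P u)) d' t ∧
        d' ≤ -R * (x t - x 0 * Real.exp (-(R * t)) - (A + P t)) := by
    intro t ht
    obtain ⟨x', hx', hb⟩ := hd t ht
    refine ⟨_, (hx'.sub (hex t)).sub ((hPd t ht).const_add A), ?_⟩
    have hP' := mul_nonneg hR (hPnn t ht)
    linarith
  have h0 : (fun u => x u - x 0 * Real.exp (-(R * u)) - (A + P u)) 0 ≤ 0 := by
    show x 0 - x 0 * Real.exp (-(R * 0)) - (A + P 0) ≤ 0
    rw [mul_zero, neg_zero, Real.exp_zero, mul_one, hP0]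
    linarith
  intro τ hτ
  have h := trailPair_nonpos_of_deriv_le (K := fun _ => -R) hT continuousOn_const hdc h0 hdd τ hτ
  linarith

/-- **Pre-ignition carrier under the bootstrap box (variation of constants).** If `|x| ≤ 1/20`,
`|y| ≤ 2ε̄`, `mx ≤ ε̄ + Bx/20` on `[0, T]`, then the forcing of `x' + q⁴x = q w² + F` obeys
`|F| ≤ q⁴ A` with `A = 5ε̄² + η(ε̄ + Bx/20) ≤ 10⁻³` (`F = -q⁴y² - q⁴ε̄xy + eₓ`), so
`x(0)e^{-q⁴σ} - A ≤ x(σ) ≤ x(0)e^{-q⁴σ} + A + q ∫₀^σ w²` (`levelOnePre_carrier_upper` for `x` with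
`P = q ∫₀^σ w²` and for `-x` with `P = 0`), whence `|x| ≤ ε̄ + q Iw + 10⁻³`. [folklore] -/
theorem levelOnePre_carrier {x y w mx ex : ℝ → ℝ} {q η εb Bx Iw T : ℝ}
    (hq1 : 1 ≤ q) (hη : 0 ≤ η) (hεb : 0 < εb) (hεb1 : εb ≤ 1 / 10 ^ 6) (hBx : 1 ≤ Bx)
    (hηBx : η * Bx ≤ 1 / 10 ^ 4) (hIw : 0 ≤ Iw) (hT : 0 ≤ T)
    (hx : ContinuousOn x (Icc 0 T)) (hw : ContinuousOn w (Icc 0 T))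
    (hdx : ∀ σ ∈ Ioo 0 T, HasDerivAt x
      (q ^ 4 * (-(x σ) + (w σ) ^ 2 / q ^ 3 - (y σ) ^ 2 - εb * x σ * y σ) + ex σ) σ)
    (hexb : ∀ σ ∈ Icc 0 T, |ex σ| ≤ η * q ^ 4 * mx σ)
    (hwI : ∀ σ ∈ Icc 0 T, ∫ u in (0 : ℝ)..σ, (w u) ^ 2 ≤ Iw) (hx0 : |x 0| ≤ εb)
    (hQ : ∀ σ ∈ Icc 0 T, |x σ| ≤ 1 / 20 ∧ |y σ| ≤ 2 * εb ∧ mx σ ≤ εb + Bx / 20) :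
    ∀ σ ∈ Icc 0 T, |x σ| ≤ εb + q * Iw + 1 / 10 ^ 3 := by
  have hqpos : 0 < q := by linarith
  have hqne : q ≠ 0 := hqpos.ne'
  have hq4pos : 0 < q ^ 4 := by positivity
  have hη4 : η ≤ 1 / 10 ^ 4 :=
    calc η = η * 1 := (mul_one η).symm
      _ ≤ η * Bx := mul_le_mul_of_nonneg_left hBx hη
      _ ≤ 1 / 10 ^ 4 := hηBx
  have hεbsq : εb ^ 2 ≤ εb * (1 / 10 ^ 6) := by
    rw [sq]
    exact mul_le_mul_of_nonneg_left hεb1 hεb.le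
  have hηεb : η * εb ≤ 1 / 10 ^ 4 * εb := mul_le_mul_of_nonneg_right hη4 hεb.le
  have hA0 : 0 ≤ 5 * εb ^ 2 + η * (εb + Bx / 20) := by positivity
  have hA1 : 5 * εb ^ 2 + η * (εb + Bx / 20) ≤ 1 / 10 ^ 3 := by linarith
  have hkey : ∀ t, q ^ 4 * ((w t) ^ 2 / q ^ 3) = q * (w t) ^ 2 := fun t => by
    field_simp
  -- the forcing bound at interior points
  have hforce : ∀ t ∈ Ioo 0 T,
      -(q ^ 4 * (y t) ^ 2) - q ^ 4 * (εb * x t * y t) + ex t ≤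
          q ^ 4 * (5 * εb ^ 2 + η * (εb + Bx / 20)) ∧
        q ^ 4 * (y t) ^ 2 + q ^ 4 * (εb * x t * y t) - ex t ≤
          q ^ 4 * (5 * εb ^ 2 + η * (εb + Bx / 20)) := by
    intro t ht
    have htI : t ∈ Icc 0 T := ⟨ht.1.le, ht.2.le⟩
    obtain ⟨hxu, hyu, hmxu⟩ := hQ t htI
    have hy' := abs_le.1 hyu
    have h4 : (y t) ^ 2 ≤ (2 * εb) ^ 2 := sq_le_sq' (by linarith) hy'.2
    have h4e : q ^ 4 * (2 * εb) ^ 2 = 4 * (q ^ 4 * εb ^ 2) := by ring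
    have h4' : q ^ 4 * (y t) ^ 2 ≤ q ^ 4 * (2 * εb) ^ 2 := mul_le_mul_of_nonneg_left h4 hq4pos.le
    have h8 : 0 ≤ q ^ 4 * (y t) ^ 2 := by positivity
    have h5 : |x t * y t| ≤ 1 / 20 * (2 * εb) := by
      rw [abs_mul]
      exact mul_le_mul hxu hyu (abs_nonneg _) (by norm_num)
    have h6 : |q ^ 4 * (εb * x t * y t)| ≤ q ^ 4 * (εb * (1 / 20 * (2 * εb))) := by
      rw [abs_mul, abs_of_pos hq4pos, mul_assoc εb, abs_mul, abs_of_pos hεb]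
      exact mul_le_mul_of_nonneg_left (mul_le_mul_of_nonneg_left h5 hεb.le) hq4pos.le
    have h6e : q ^ 4 * (εb * (1 / 20 * (2 * εb))) = 1 / 10 * (q ^ 4 * εb ^ 2) := by ring
    have h7 : |ex t| ≤ η * q ^ 4 * (εb + Bx / 20) :=
      (hexb t htI).trans (mul_le_mul_of_nonneg_left hmxu (by positivity))
    have h6' := abs_le.1 h6
    have h7' := abs_le.1 h7
    have h9 : 0 ≤ q ^ 4 * εb ^ 2 := by positivity
    constructor <;> linarith
  obtain ⟨hPc, hPd⟩ := linearComparison_primitive hT (hw.pow 2)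
  have hxup : ∀ τ ∈ Icc 0 T, x τ - x 0 * Real.exp (-(q ^ 4 * τ)) ≤
      (5 * εb ^ 2 + η * (εb + Bx / 20)) + q * ∫ u in (0 : ℝ)..τ, (w u) ^ 2 := by
    refine levelOnePre_carrier_upper (P := fun t => q * ∫ u in (0 : ℝ)..t, (w u) ^ 2)
      (p := fun t => q * (w t) ^ 2) hT hq4pos.le hA0 hx (continuousOn_const.mul hPc) ?_ ?_ ?_ ?_
    · show q * ∫ u in (0 : ℝ)..0, (w u) ^ 2 = 0
      rw [intervalIntegral.integral_same, mul_zero]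
    · intro t ht
      exact mul_nonneg hqpos.le
        (intervalIntegral.integral_nonneg ht.1.le fun u _ => sq_nonneg (w u))
    · intro t ht
      exact (hPd t ht).const_mul q
    · intro t ht
      refine ⟨_, hdx t ht, ?_⟩
      have h := (hforce t ht).1
      have hk := hkey t
      linarith
  have hxlo : ∀ τ ∈ Icc 0 T, -x τ - -x 0 * Real.exp (-(q ^ 4 * τ)) ≤
      (5 * εb ^ 2 + η * (εb + Bx / 20)) + 0 := by
    refine levelOnePre_carrier_upper (x := fun t => -x t) (P := fun _ => 0) (p := fun _ => 0)
      hT hq4pos.le hA0 hx.neg continuousOn_const rfl (fun _ _ => le_rfl)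
      (fun t _ => hasDerivAt_const t 0) ?_
    intro t ht
    refine ⟨_, (hdx t ht).neg, ?_⟩
    have h := (hforce t ht).2
    have hk := hkey t
    have hw2 : 0 ≤ q * (w t) ^ 2 := by positivity
    linarith
  intro σ hσ
  have hu := hxup σ hσ
  have hl := hxlo σ hσ
  have hE0 : 0 < Real.exp (-(q ^ 4 * σ)) := Real.exp_pos _
  have hE1 : Real.exp (-(q ^ 4 * σ)) ≤ 1 :=
    Real.exp_le_one_iff.2 (neg_nonpos.2 (mul_nonneg hq4pos.le hσ.1))
  have h1 : |x 0 * Real.exp (-(q ^ 4 * σ))| ≤ εb := by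
    rw [abs_mul, abs_of_pos hE0]
    exact (mul_le_of_le_one_right (abs_nonneg _) hE1).trans hx0
  have h1' := abs_le.1 h1
  have h3 : q * ∫ u in (0 : ℝ)..σ, (w u) ^ 2 ≤ q * Iw :=
    mul_le_mul_of_nonneg_left (hwI σ hσ) hqpos.le
  have h4 : 0 ≤ q * Iw := by positivity
  rw [abs_le]
  constructor <;> linarith

/-- **Pre-ignition bond under the bootstrap box (damping).** If `|x| ≤ 1/20` and `my ≤ 8ε̄` on
`[0, T]` (with `|x₂| ≤ 1/2`, `q ≥ 1`, `η ≤ 10⁻⁴`), then the bond rate is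
`q⁴(x - x₂/q - 1) ≤ -(9/20)q⁴` and the forcing obeys `|q⁴ε̄x² + e_y| ≤ q⁴ε̄(1/400 + 8η)`, so
`trailPair_bond` gives `|y| ≤ ε̄(1/400 + 8η)(20/9) + ε̄ ≤ (11/10)ε̄` on `[0, T]`. [folklore] -/
theorem levelOnePre_bond {x y x2 my ey : ℝ → ℝ} {q η εb Bx T : ℝ}
    (hq1 : 1 ≤ q) (hη : 0 ≤ η) (hεb : 0 < εb) (hBx : 1 ≤ Bx) (hηBx : η * Bx ≤ 1 / 10 ^ 4)
    (hT : 0 ≤ T) (hx : ContinuousOn x (Icc 0 T)) (hy : ContinuousOn y (Icc 0 T))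
    (hx2 : ContinuousOn x2 (Icc 0 T))
    (hdy : ∀ σ ∈ Ioo 0 T, HasDerivAt y
      (q ^ 4 * (y σ * (x σ - x2 σ / q - 1) + εb * (x σ) ^ 2) + ey σ) σ)
    (heyb : ∀ σ ∈ Icc 0 T, |ey σ| ≤ η * q ^ 4 * my σ)
    (hx2b : ∀ σ ∈ Icc 0 T, |x2 σ| ≤ 1 / 2) (hy0 : |y 0| ≤ εb)
    (hQ : ∀ σ ∈ Icc 0 T, |x σ| ≤ 1 / 20 ∧ my σ ≤ 8 * εb) :
    ∀ σ ∈ Icc 0 T, |y σ| ≤ 11 / 10 * εb := by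
  have hqpos : 0 < q := by linarith
  have hq4pos : 0 < q ^ 4 := by positivity
  have hη4 : η ≤ 1 / 10 ^ 4 :=
    calc η = η * 1 := (mul_one η).symm
      _ ≤ η * Bx := mul_le_mul_of_nonneg_left hBx hη
      _ ≤ 1 / 10 ^ 4 := hηBx
  have hρ : 0 < 9 / 20 * q ^ 4 := by positivity
  have ha : 0 ≤ q ^ 4 * (εb / 400) + η * q ^ 4 * (8 * εb) := by positivity
  have hbond : ∀ τ ∈ Icc 0 T, |y τ| ≤
      (q ^ 4 * (εb / 400) + η * q ^ 4 * (8 * εb)) / (9 / 20 * q ^ 4) +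
        (εb + 0 * τ) * Real.exp (-(9 / 20 * q ^ 4 * τ)) := by
    refine trailPair_bond (θ := 9 / 20 * q ^ 4) (r := fun t => q ^ 4 * (x t - x2 t / q - 1))
      hT ha le_rfl hρ le_rfl hy
      (continuousOn_const.mul ((hx.sub (hx2.div_const q)).sub continuousOn_const)) ?_ hy0 ?_
    · intro t ht
      have htI : t ∈ Icc 0 T := ⟨ht.1.le, ht.2.le⟩
      have h1 := (abs_le.1 (hQ t htI).1).2
      have hq' : |x2 t / q| ≤ 1 / 2 := by
        rw [abs_div, abs_of_pos hqpos]
        exact (div_le_self (abs_nonneg _) hq1).trans (hx2b t htI)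
      have h2 := (abs_le.1 hq').1
      show q ^ 4 * (x t - x2 t / q - 1) ≤ -(9 / 20 * q ^ 4)
      have h3 : q ^ 4 * (x t - x2 t / q - 1) ≤ q ^ 4 * (-(9 / 20)) :=
        mul_le_mul_of_nonneg_left (by linarith) hq4pos.le
      linarith
    · intro t ht
      have htI : t ∈ Icc 0 T := ⟨ht.1.le, ht.2.le⟩
      refine ⟨_, hdy t ht, ?_⟩
      show |q ^ 4 * (y t * (x t - x2 t / q - 1) + εb * (x t) ^ 2) + ey t -
          q ^ 4 * (x t - x2 t / q - 1) * y t| ≤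
        q ^ 4 * (εb / 400) + η * q ^ 4 * (8 * εb) + 0 * Real.exp (-(9 / 20 * q ^ 4 * t))
      have key : q ^ 4 * (y t * (x t - x2 t / q - 1) + εb * (x t) ^ 2) + ey t -
          q ^ 4 * (x t - x2 t / q - 1) * y t = q ^ 4 * (εb * (x t) ^ 2) + ey t := by ring
      rw [key, zero_mul, add_zero]
      obtain ⟨hxu, hmyu⟩ := hQ t htI
      have hx' := abs_le.1 hxu
      have h3 : (x t) ^ 2 ≤ (1 / 20) ^ 2 := sq_le_sq' hx'.1 hx'.2
      have h4 : 0 ≤ q ^ 4 * (εb * (x t) ^ 2) := by positivity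
      have h5 : q ^ 4 * (εb * (x t) ^ 2) ≤ q ^ 4 * (εb * (1 / 20) ^ 2) :=
        mul_le_mul_of_nonneg_left (mul_le_mul_of_nonneg_left h3 hεb.le) hq4pos.le
      have h5e : q ^ 4 * (εb * (1 / 20) ^ 2) = q ^ 4 * (εb / 400) := by ring
      have h6 : |ey t| ≤ η * q ^ 4 * (8 * εb) :=
        (heyb t htI).trans (mul_le_mul_of_nonneg_left hmyu (by positivity))
      have h7 := abs_le.1 h6
      rw [abs_le]
      constructor <;> linarith
  intro σ hσ
  have h := hbond σ hσ
  have hE1 : Real.exp (-(9 / 20 * q ^ 4 * σ)) ≤ 1 :=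
    Real.exp_le_one_iff.2 (neg_nonpos.2 (mul_nonneg hρ.le hσ.1))
  have h1 : (εb + 0 * σ) * Real.exp (-(9 / 20 * q ^ 4 * σ)) ≤ εb := by
    rw [zero_mul, add_zero]
    exact mul_le_of_le_one_right hεb.le hE1
  have h2 : (q ^ 4 * (εb / 400) + η * q ^ 4 * (8 * εb)) / (9 / 20 * q ^ 4) ≤ εb / 10 := by
    rw [div_le_iff₀ hρ]
    have key : q ^ 4 * εb * (1 / 400 + 8 * η) ≤ q ^ 4 * εb * (9 / 200) :=
      mul_le_mul_of_nonneg_left (by linarith) (by positivity)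
    linarith
  linarith

end Summit.NavierStokesRegularity.NavierStokesRegularity.Theorems.PerpetualPumpAveragedTypeIBlowup

end
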